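import Literature.NumberTheory.PAdicHodge.FormalGroupDivisionHeightOne
import Literature.NumberTheory.EllipticCurves.TateModuleMonogenic
import HarnessLib

/-!
# The Tate module of a height-one formal group over `𝒪_{ℂ_F}` is `ℤ_p`

For a Weierstrass equation `W` over a discrete coefficient ring `A → 𝒪_{ℂ_F}` whose multiplication-by-`p`
series `[p]_W` has a UNIT coefficient at `Xᵖ` (height one = ORDINARY reduction) we prove, from the
Weierstrass preparation theorem over `𝒪_{ℂ_F}` (`FormalGroupDivisionHeightOne`):

* `card_zeros_le_of_coeff_mem_of_isUnit` — ★ a series `G ∈ 𝒪_{ℂ_F}⟦X⟧` with `[Xⁱ]G ∈ I (i < n)`,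
  `[Xⁿ]G` a unit (`I ≠ ⊤`, `𝒪_{ℂ_F}` `I`-adically complete) has AT MOST `n` zeros in `𝔪_{ℂ_F}`
  (they are roots of the distinguished polynomial `Xⁿ − r` of Weierstrass division `Xⁿ = Gq + r`).
* `card_torsion_pt_le_of_isUnit` — ★★ `#Ŵ[p](𝔪_{ℂ_F}) ≤ p` at height one.
* `exists_ne_zero_aeval_formalMul_prime_eq_zero` — ★★ `[p]_W` has a NON-ZERO zero in `𝔪_{ℂ_F}`
  (if all `p` roots of `Xᵖ − r` in `ℂ_F` were `0` then `Xᵖ − r = Xᵖ`, but `[X¹](Xᵖ − r) = p·q(0) ≠ 0`).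
* `exists_pt_nsmul_eq`, `exists_pt_ne_zero_nsmul_eq_zero`, `exists_tateModule_pt_ne_zero` —
  division by `p` on `Ŵ(𝔪_{ℂ_F})`, a point of exact order `p`, and `T_pŴ ≠ 0` (a `[p]`-division tower
  above a non-zero `p`-torsion point).

Combined with `TateModuleMonogenic` (`#A[p] ≤ p`, `T_p A ≠ 0` ⇒ `T_p A = ℤ_p v₀`) this gives
`T_pŴ(𝔪_{ℂ_F}) = ℤ_p · v₀`, `v₀ ≠ 0`, and the unit-root character `ρ : Γ_F → ℤ_p` of an ordinary curve.

References: Silverman, *AEC* IV.4.4, IV.7 (heights), VII.2; Lubin–Tate (1965) §1; Tate, *p-divisible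
groups* (1967) §2.
-/

noncomputable section

open scoped Classical
open Polynomial PowerSeries Field ValuativeRel

namespace Literature.NumberTheory.PAdicHodge

open Literature.NumberTheory.GaloisRepresentations
open Literature.NumberTheory.GaloisRepresentations.IsNonarchimedeanLocalField
open Literature.NumberTheory.GaloisRepresentations.LubinTate
open Literature.NumberTheory.EllipticCurves

variable {F : Type} [Field F] [ValuativeRel F] [TopologicalSpace F] [IsNonarchimedeanLocalField F] [CharZero F]
  {p : ℕ} [Fact p.Prime] [Fact (¬ IsUnit (p : integerC F))] [IsAdicComplete (Ideal.span {(p : integerC F)}) (integerC F)]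
  [CharZero (CompletedAlgClosure F)]

/-! ## §1 Zeros of a Weierstrass-regular series: at most `n` -/

omit [CharZero F] [Fact p.Prime] [Fact (¬ IsUnit (p : integerC F))] [IsAdicComplete (Ideal.span {(p : integerC F)}) (integerC F)]
  [CharZero (CompletedAlgClosure F)] in
set_option maxHeartbeats 800000 in
/-- ★ **A Weierstrass-regular series has at most `n` zeros in `𝔪_{ℂ_F}`.** Let `I ≠ ⊤` be an ideal of `𝒪_{ℂ_F}` for which `𝒪_{ℂ_F}` is
`I`-adically complete, `G ∈ 𝒪_{ℂ_F}⟦X⟧` with `[Xⁱ]G ∈ I` for `i < n` and `[Xⁿ]G` a unit. Then every finite set of zeros of `G` in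
`𝔪_{ℂ_F}` has at most `n` members: by Weierstrass division `Xⁿ = Gq + r` each zero is a root of the monic polynomial `Xⁿ − r` of
degree `n` over the domain `𝒪_{ℂ_F}`. [cite: Washington1997, Prop. 7.2 and Thm. 7.3] [cite: LubinTate1965, §1] -/
theorem card_zeros_le_of_coeff_mem_of_isUnit {I : Ideal (CBall F)} [IsAdicComplete I (CBall F)] (hItop : I ≠ ⊤)
    {G : (CBall F)⟦X⟧} {n : ℕ} (hlow : ∀ i < n, PowerSeries.coeff i G ∈ I) (hunit : IsUnit (PowerSeries.coeff n G))
    (s : Finset (maxNilIdealC F).toIdeal)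
    (hs : ∀ x ∈ s, PowerSeries.aeval ((maxNilIdealC F).isTopologicallyNilpotent _ x.2) G = 0) :
    s.card ≤ n := by
  have hord : (G.map (Ideal.Quotient.mk I)).order = n := by
    refine PowerSeries.order_eq_nat.2 ⟨?_, fun i hi => ?_⟩
    · rw [PowerSeries.coeff_map]
      intro h0
      rw [Ideal.Quotient.eq_zero_iff_mem] at h0
      exact hItop (Ideal.eq_top_of_isUnit_mem _ h0 hunit)
    · rw [PowerSeries.coeff_map, Ideal.Quotient.eq_zero_iff_mem]
      exact hlow i hi
  have hordn : (G.map (Ideal.Quotient.mk I)).order.toNat = n := by rw [hord]; rfl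
  have H : G.IsWeierstrassDivisorAt I := by
    rw [PowerSeries.IsWeierstrassDivisorAt, hordn]; exact hunit
  obtain ⟨hdeg, heq⟩ := H.isWeierstrassDivisionAt_div_mod (PowerSeries.X ^ n)
  set q := H.div (PowerSeries.X ^ n) with hq
  set r := H.mod (PowerSeries.X ^ n) with hr
  rw [hordn] at hdeg
  have hdeg' : r.natDegree < n ∨ n = 0 := by
    rcases eq_or_ne r 0 with h0 | h0
    · rcases Nat.eq_zero_or_pos n with hn | hn
      · exact Or.inr hn
      · left; rw [h0, Polynomial.natDegree_zero]; exact hn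
    · exact Or.inl ((Polynomial.natDegree_lt_iff_degree_lt h0).2 hdeg)
  -- the distinguished polynomial
  set P : (CBall F)[X] := Polynomial.X ^ n - r with hP
  have hPmonic : P.Monic := Polynomial.Monic.sub_of_left (Polynomial.monic_X_pow n) (by rwa [Polynomial.degree_X_pow])
  have hPnat : P.natDegree = n := by
    rcases hdeg' with hdeg' | hn
    · rw [hP, Polynomial.natDegree_sub_eq_left_of_natDegree_lt (by rwa [Polynomial.natDegree_X_pow]), Polynomial.natDegree_X_pow]
    · subst hn
      have hr0 : r = 0 := by
        by_contra h0
        rw [Polynomial.degree_eq_natDegree h0] at hdeg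
        exact absurd hdeg (by exact_mod_cast (Nat.not_lt_zero _))
      rw [hP, hr0, sub_zero, Polynomial.natDegree_X_pow]
  -- every zero of `G` in `𝔪` is a root of `P`
  have hroot : ∀ x ∈ s, (x : CBall F) ∈ P.roots := by
    intro x hx
    rw [Polynomial.mem_roots hPmonic.ne_zero, Polynomial.IsRoot.def]
    have hev := congrArg (PowerSeries.aeval ((maxNilIdealC F).isTopologicallyNilpotent _ x.2)) heq
    have hX : PowerSeries.aeval ((maxNilIdealC F).isTopologicallyNilpotent _ x.2) (PowerSeries.X : (CBall F)⟦X⟧) = (x : CBall F) := by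
      rw [PowerSeries.coe_aeval, PowerSeries.eval₂_X]
    rw [map_pow, hX, map_add, map_mul, PowerSeries.aeval_coe, hs x hx, zero_mul, zero_add, Polynomial.coe_aeval_eq_eval] at hev
    rw [hP, Polynomial.eval_sub, Polynomial.eval_pow, Polynomial.eval_X, hev, sub_self]
  calc s.card = (s.image fun x : (maxNilIdealC F).toIdeal => (x : CBall F)).card :=
        (Finset.card_image_of_injective _ Subtype.val_injective).symm
    _ ≤ P.roots.toFinset.card := Finset.card_le_card fun y hy => by
        obtain ⟨x, hx, rfl⟩ := Finset.mem_image.1 hy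
        exact Multiset.mem_toFinset.2 (hroot x hx)
    _ ≤ P.roots.card := Multiset.toFinset_card_le _
    _ ≤ P.natDegree := Polynomial.card_roots' P
    _ = n := hPnat

/-! ## §2 `#Ŵ[p](𝔪_{ℂ_F}) ≤ p` at height one -/

omit [CharZero F] [Fact p.Prime] [Fact (¬ IsUnit (p : integerC F))] [IsAdicComplete (Ideal.span {(p : integerC F)}) (integerC F)]
  [CharZero (CompletedAlgClosure F)] in
/-- The ideal `(p) ⊂ 𝒪_{ℂ_F}` is proper (`‖p‖ < 1`). [cite: FontaineOuyang2022, §3.1] -/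
theorem span_natCast_cBall_ne_top (hpC : ‖(p : CompletedAlgClosure F)‖ < 1) : Ideal.span {(p : CBall F)} ≠ ⊤ := by
  rw [Ne, Ideal.span_singleton_eq_top, AinfTop.isUnit_unitBall_iff]
  have e1 : ((p : CBall F) : CompletedAlgClosure F) = (p : CompletedAlgClosure F) := by simp
  rw [e1]
  exact hpC.ne

omit [CharZero F] [Fact (¬ IsUnit (p : integerC F))] [IsAdicComplete (Ideal.span {(p : integerC F)}) (integerC F)]
  [CharZero (CompletedAlgClosure F)] in
/-- The low coefficients of `[p]_W` lie in `(p)`: `[X⁰][p] = 0` and `[Xⁱ][p] = p·[Xⁱ]([p]-p-part)` for `0 < i < p`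
(`[p] = p·f + g(Xᵖ)`). [cite: SilvermanAEC2009, Cor. IV.4.4] -/
theorem coeff_formalMul_prime_mem_span_of_lt (W : WeierstrassCurve (CBall F)) {i : ℕ} (hi : i < p) :
    PowerSeries.coeff i (W.formalMul p) ∈ Ideal.span {(p : CBall F)} := by
  have hp : p.Prime := Fact.out
  rcases Nat.eq_zero_or_pos i with h0 | hpos
  · rw [h0, PowerSeries.coeff_zero_eq_constantCoeff, W.constantCoeff_formalMul]; exact Ideal.zero_mem _
  · have hpi : ¬ p ∣ i := fun hdvd => absurd (Nat.le_of_dvd hpos hdvd) (not_le.2 hi)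
    rw [W.formalMul_prime_eq_add_expand p, map_add, ← map_natCast (PowerSeries.C (R := CBall F)) p, PowerSeries.coeff_C_mul,
      PowerSeries.coeff_expand, if_neg hpi, add_zero]
    exact Ideal.mul_mem_right _ _ (Ideal.subset_span rfl)

omit [CharZero F] [Fact (¬ IsUnit (p : integerC F))] [CharZero (CompletedAlgClosure F)] in
/-- ★★ **`#Ŵ[p](𝔪_{ℂ_F}) ≤ p` at height one.** If `[Xᵖ][p]_W` maps to a unit of `𝒪_{ℂ_F}` (`W` over a discrete coefficient ring
`A → 𝒪_{ℂ_F}`), then every finite set of `p`-torsion points of `Ŵ(𝔪_{ℂ_F})` has at most `p` members (the `p`-torsion points are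
zeros of the Weierstrass-regular series `[p]_W` of order `p` mod `(p)`). [cite: SilvermanAEC2009, IV.7] [cite: LubinTate1965, §1] -/
theorem card_torsion_pt_le_of_isUnit {A : Type*} [CommRing A] [UniformSpace A] [DiscreteUniformity A] [Algebra A (CBall F)]
    [ContinuousSMul A (CBall F)] (hpC : ‖(p : CompletedAlgClosure F)‖ < 1) (W : WeierstrassCurve A)
    (h1 : IsUnit (algebraMap A (CBall F) (PowerSeries.coeff p (W.formalMul p))))
    (s : Finset (W.Pt (maxNilIdealC F))) (hs : ∀ P ∈ s, p • P = 0) : s.card ≤ p := by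
  haveI := isAdicComplete_span_natCast_cBall (F := F) (p := p)
  have h1' : IsUnit (PowerSeries.coeff p ((W.map (algebraMap A (CBall F))).formalMul p)) := by
    rw [← WeierstrassCurve.map_formalMul, PowerSeries.coeff_map]; exact h1
  have hzero : ∀ x ∈ s.image (fun P : W.Pt (maxNilIdealC F) => P.val),
      PowerSeries.aeval ((maxNilIdealC F).isTopologicallyNilpotent _ x.2) ((W.map (algebraMap A (CBall F))).formalMul p) = 0 := by
    intro x hx
    obtain ⟨P, hP, rfl⟩ := Finset.mem_image.1 hx
    rw [← WeierstrassCurve.map_formalMul, aeval_map_algebraMap_eq_evalPt₁ (W.formalMul p) (W.constantCoeff_formalMul p),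
      (WeierstrassCurve.Pt.nsmul_eq_zero_iff p P).1 (hs P hP), ZeroMemClass.coe_zero]
  calc s.card = (s.image fun P : W.Pt (maxNilIdealC F) => P.val).card :=
        (Finset.card_image_of_injective _ WeierstrassCurve.Pt.val_injective).symm
    _ ≤ p := card_zeros_le_of_coeff_mem_of_isUnit (span_natCast_cBall_ne_top hpC)
        (fun i hi => coeff_formalMul_prime_mem_span_of_lt _ hi) h1' _ hzero

/-! ## §3 A point of order `p`, division by `p`, and `T_pŴ ≠ 0` -/

omit [Fact (¬ IsUnit (p : integerC F))] in
set_option maxHeartbeats 1600000 in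
/-- ★★ **`[p]_W` has a non-zero zero in `𝔪_{ℂ_F}` at height one.** With `Xᵖ = [p]q + r` the Weierstrass division at `(p)`
(`q(0)` a unit, `r ≡ 0 mod p`), the distinguished polynomial `Xᵖ − r` has `[X¹] = p·q(0) ≠ 0`, so not all of its `p` roots in the
algebraically closed `ℂ_F` vanish; a non-zero root lies in `𝔪_{ℂ_F}` and is a zero of `[p]`. [cite: SilvermanAEC2009, IV.7] [cite: LubinTate1965, §1] -/
theorem exists_ne_zero_aeval_formalMul_prime_eq_zero (hpC : ‖(p : CompletedAlgClosure F)‖ < 1) (W : WeierstrassCurve (CBall F))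
    (h1 : IsUnit (PowerSeries.coeff p (W.formalMul p))) :
    ∃ x : (maxNilIdealC F).toIdeal, (x : CBall F) ≠ 0 ∧
      PowerSeries.aeval ((maxNilIdealC F).isTopologicallyNilpotent _ x.2) (W.formalMul p) = 0 := by
  have hp : p.Prime := Fact.out
  haveI := isAdicComplete_span_natCast_cBall (F := F) (p := p)
  set I : Ideal (CBall F) := Ideal.span {(p : CBall F)} with hIdef
  have hItop : I ≠ ⊤ := span_natCast_cBall_ne_top hpC
  have hI : ∀ x ∈ I, ‖(x : CompletedAlgClosure F)‖ < 1 := by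
    intro x hx
    obtain ⟨c, rfl⟩ := Ideal.mem_span_singleton'.1 hx
    rw [Subring.coe_mul, norm_mul]
    have e1 : ((p : CBall F) : CompletedAlgClosure F) = (p : CompletedAlgClosure F) := by simp
    rw [e1]
    calc ‖(c : CompletedAlgClosure F)‖ * ‖(p : CompletedAlgClosure F)‖ ≤ 1 * ‖(p : CompletedAlgClosure F)‖ :=
          mul_le_mul_of_nonneg_right ((mem_unitBall_iff _).1 c.2) (norm_nonneg _)
      _ < 1 := by rw [one_mul]; exact hpC
  set G : (CBall F)⟦X⟧ := W.formalMul p with hG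
  have hlow : ∀ i < p, PowerSeries.coeff i G ∈ I := fun i hi => coeff_formalMul_prime_mem_span_of_lt W hi
  have hG0 : PowerSeries.coeff 0 G = 0 := by rw [PowerSeries.coeff_zero_eq_constantCoeff, W.constantCoeff_formalMul]
  have hG1 : PowerSeries.coeff 1 G = p := W.coeff_one_formalMul' p
  -- Weierstrass division of `Xᵖ`
  have hord : (G.map (Ideal.Quotient.mk I)).order = p := by
    refine PowerSeries.order_eq_nat.2 ⟨?_, fun i hi => ?_⟩
    · rw [PowerSeries.coeff_map]
      intro h0
      rw [Ideal.Quotient.eq_zero_iff_mem] at h0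
      exact hItop (Ideal.eq_top_of_isUnit_mem _ h0 h1)
    · rw [PowerSeries.coeff_map, Ideal.Quotient.eq_zero_iff_mem]
      exact hlow i hi
  have hordn : (G.map (Ideal.Quotient.mk I)).order.toNat = p := by rw [hord]; rfl
  have H : G.IsWeierstrassDivisorAt I := by
    rw [PowerSeries.IsWeierstrassDivisorAt, hordn]; exact h1
  obtain ⟨hdeg, heq⟩ := H.isWeierstrassDivisionAt_div_mod (PowerSeries.X ^ p)
  set q := H.div (PowerSeries.X ^ p) with hq
  set r := H.mod (PowerSeries.X ^ p) with hr
  rw [hordn] at hdeg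
  have hdeg' : r.natDegree < p := by
    rcases eq_or_ne r 0 with h0 | h0
    · rw [h0, Polynomial.natDegree_zero]; exact hp.pos
    · exact (Polynomial.natDegree_lt_iff_degree_lt h0).2 hdeg
  have hrI : ∀ i, r.coeff i ∈ I := by
    intro i
    by_cases hi : i < p
    · have h := (H.isWeierstrassDivisionAt_div_mod (PowerSeries.X ^ p)).coeff_f_sub_r_mem (i := i) (by rw [hordn]; exact hi)
      rw [map_sub, PowerSeries.coeff_X_pow, if_neg hi.ne, zero_sub, Polynomial.coeff_coe, neg_mem_iff] at h
      exact h
    · rw [Polynomial.coeff_eq_zero_of_natDegree_lt (lt_of_lt_of_le hdeg' (not_lt.1 hi))]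
      exact I.zero_mem
  -- `q(0)` is a unit
  have hq0 : IsUnit (PowerSeries.constantCoeff q) := by
    have hcoef := congrArg (PowerSeries.coeff p) heq
    rw [PowerSeries.coeff_X_pow_self, map_add, Polynomial.coeff_coe, Polynomial.coeff_eq_zero_of_natDegree_lt hdeg', add_zero,
      PowerSeries.coeff_mul] at hcoef
    have hmem : ((p, 0) : ℕ × ℕ) ∈ Finset.HasAntidiagonal.antidiagonal p := Finset.HasAntidiagonal.mem_antidiagonal.2 (add_zero p)
    rw [← Finset.add_sum_erase _ _ hmem, PowerSeries.coeff_zero_eq_constantCoeff] at hcoef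
    have hrest : ∑ x ∈ (Finset.HasAntidiagonal.antidiagonal p).erase (p, 0), PowerSeries.coeff x.1 G * PowerSeries.coeff x.2 q ∈ I := by
      refine I.sum_mem fun x hx => ?_
      obtain ⟨hx2, hx1⟩ := Finset.mem_erase.1 hx
      have hsum := Finset.HasAntidiagonal.mem_antidiagonal.1 hx1
      have hlt : x.1 < p := by
        rcases lt_or_eq_of_le (Nat.le.intro hsum) with h | h
        · exact h
        · exfalso; refine hx2 ?_
          ext
          · exact h
          · simpa [h] using hsum
      exact I.mul_mem_right _ (hlow _ hlt)
    have hGq : IsUnit (PowerSeries.coeff p G * PowerSeries.constantCoeff q) := by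
      have e1 : PowerSeries.coeff p G * PowerSeries.constantCoeff q =
          1 - ∑ x ∈ (Finset.HasAntidiagonal.antidiagonal p).erase (p, 0), PowerSeries.coeff x.1 G * PowerSeries.coeff x.2 q := by
        dsimp only at hcoef
        linear_combination -hcoef
      rw [e1, AinfTop.isUnit_unitBall_iff, AddSubgroupClass.coe_sub, OneMemClass.coe_one]
      have hlt1 := hI _ hrest
      rw [sub_eq_add_neg, IsUltrametricDist.norm_add_eq_max_of_norm_ne_norm (by rw [norm_one, norm_neg]; exact (ne_of_lt hlt1).symm),
        norm_one, norm_neg, max_eq_left hlt1.le]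
    exact isUnit_of_mul_isUnit_right hGq
  -- NEW: the coefficient of `X¹` in `r` is `-p·q(0)`
  have hr1 : r.coeff 1 = -((p : CBall F) * PowerSeries.constantCoeff q) := by
    have hcoef := congrArg (PowerSeries.coeff 1) heq
    rw [PowerSeries.coeff_X_pow, if_neg hp.one_lt.ne, map_add, Polynomial.coeff_coe, PowerSeries.coeff_mul,
      Finset.Nat.sum_antidiagonal_eq_sum_range_succ_mk, Finset.sum_range_succ, Finset.sum_range_succ, Finset.sum_range_zero,
      zero_add, Nat.sub_zero, Nat.sub_self, hG0, zero_mul, zero_add, hG1, PowerSeries.coeff_zero_eq_constantCoeff] at hcoef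
    linear_combination -hcoef
  -- the distinguished polynomial and its roots in `ℂ_F`
  haveI : IsAlgClosed (CompletedAlgClosure F) := CompletedAlgClosure.isAlgClosed (F := F)
  set P : (CBall F)[X] := Polynomial.X ^ p - r with hP
  have hPmonic : P.Monic := Polynomial.Monic.sub_of_left (Polynomial.monic_X_pow p) (by rwa [Polynomial.degree_X_pow])
  have hPnat : P.natDegree = p := by
    rw [hP, Polynomial.natDegree_sub_eq_left_of_natDegree_lt (by rwa [Polynomial.natDegree_X_pow]), Polynomial.natDegree_X_pow]
  set Pm := P.map (algebraMap (CBall F) (CompletedAlgClosure F)) with hPm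
  have hPm_monic : Pm.Monic := hPmonic.map _
  have hPm_nat : Pm.natDegree = p := by rw [hPm, hPmonic.natDegree_map, hPnat]
  have hcard : Pm.roots.card = Pm.natDegree := IsAlgClosed.card_roots_eq_natDegree
  have hex : ∃ x ∈ Pm.roots, x ≠ 0 := by
    by_contra hall
    push Not at hall
    have hrep : Pm.roots = Multiset.replicate p 0 := Multiset.eq_replicate.2 ⟨by rw [hcard, hPm_nat], hall⟩
    have hprod := Polynomial.prod_multiset_X_sub_C_of_monic_of_roots_card_eq hPm_monic hcard
    rw [hrep, Multiset.map_replicate, map_zero, sub_zero, Multiset.prod_replicate] at hprod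
    have hc1 := congrArg (fun Q : (CompletedAlgClosure F)[X] => Q.coeff 1) hprod
    rw [Polynomial.coeff_X_pow, if_neg hp.one_lt.ne, hPm, Polynomial.coeff_map, hP, Polynomial.coeff_sub, Polynomial.coeff_X_pow,
      if_neg hp.one_lt.ne, zero_sub, hr1, neg_neg, map_mul] at hc1
    have hpC0 : algebraMap (CBall F) (CompletedAlgClosure F) (p : CBall F) ≠ 0 := by
      rw [map_natCast]; exact Nat.cast_ne_zero.2 hp.ne_zero
    have hq0C : algebraMap (CBall F) (CompletedAlgClosure F) (PowerSeries.constantCoeff q) ≠ 0 := (hq0.map _).ne_zero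
    exact mul_ne_zero hpC0 hq0C hc1.symm
  obtain ⟨x, hxroot, hx0⟩ := hex
  have hx : Polynomial.IsRoot Pm x := (Polynomial.mem_roots hPm_monic.ne_zero).1 hxroot
  have haev : Polynomial.aeval x P = 0 := by rw [Polynomial.aeval_def, ← Polynomial.eval_map]; exact hx
  -- `‖x‖ < 1`
  have heval : x ^ p = -∑ i ∈ Finset.range p, algebraMap (CBall F) (CompletedAlgClosure F) (P.coeff i) * x ^ i := by
    have h := haev
    rw [Polynomial.aeval_eq_sum_range, hPnat, Finset.sum_range_succ, ← hPnat, hPmonic.coeff_natDegree, one_smul, hPnat] at h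
    simp_rw [Algebra.smul_def] at h
    linear_combination h
  have hxlt : ‖x‖ < 1 := by
    by_contra hge
    rw [not_lt] at hge
    have hne : (Finset.range p).Nonempty := Finset.nonempty_range_iff.2 hp.ne_zero
    obtain ⟨i, hi, hle⟩ := IsUltrametricDist.exists_norm_finsetSum_le_of_nonempty hne
      (fun i => algebraMap (CBall F) (CompletedAlgClosure F) (P.coeff i) * x ^ i)
    have hi' : i < p := Finset.mem_range.1 hi
    have hterm : ‖algebraMap (CBall F) (CompletedAlgClosure F) (P.coeff i) * x ^ i‖ < ‖x‖ ^ p := by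
      rw [norm_mul, norm_pow]
      have hcoef : ‖algebraMap (CBall F) (CompletedAlgClosure F) (P.coeff i)‖ < 1 := by
        rw [hP, Polynomial.coeff_sub, Polynomial.coeff_X_pow, if_neg hi'.ne, zero_sub, map_neg, norm_neg]
        exact hI _ (hrI i)
      calc ‖algebraMap (CBall F) (CompletedAlgClosure F) (P.coeff i)‖ * ‖x‖ ^ i < 1 * ‖x‖ ^ i :=
            mul_lt_mul_of_pos_right hcoef (pow_pos (lt_of_lt_of_le one_pos hge) i)
        _ ≤ ‖x‖ ^ p := by rw [one_mul]; exact pow_le_pow_right₀ hge hi'.le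
    have hxn : ‖x‖ ^ p = ‖∑ i ∈ Finset.range p, algebraMap (CBall F) (CompletedAlgClosure F) (P.coeff i) * x ^ i‖ := by
      rw [← norm_pow, heval, norm_neg]
    exact lt_irrefl _ (lt_of_le_of_lt (hxn.le.trans hle) hterm)
  set xO : CBall F := ⟨x, (mem_unitBall_iff _).2 hxlt.le⟩ with hxO
  have hxM : xO ∈ (maxNilIdealC F).toIdeal := by change ‖x‖ < 1; exact hxlt
  refine ⟨⟨xO, hxM⟩, fun h0 => hx0 (congrArg Subtype.val h0 :), ?_⟩
  have hPx : P.eval xO = 0 := by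
    have h := Polynomial.aeval_algebraMap_apply_eq_algebraMap_eval (A := CompletedAlgClosure F) xO P
    rw [show algebraMap (CBall F) (CompletedAlgClosure F) xO = x from rfl, haev] at h
    exact Subtype.ext h.symm
  have hrx : Polynomial.aeval xO r = xO ^ p := by
    rw [Polynomial.coe_aeval_eq_eval]
    have h2 : P.eval xO = xO ^ p - r.eval xO := by rw [hP, Polynomial.eval_sub, Polynomial.eval_pow, Polynomial.eval_X]
    rw [h2, sub_eq_zero] at hPx
    exact hPx.symm
  have hev := congrArg (PowerSeries.aeval ((maxNilIdealC F).isTopologicallyNilpotent _ hxM)) heq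
  have hX : PowerSeries.aeval ((maxNilIdealC F).isTopologicallyNilpotent _ hxM) (PowerSeries.X : (CBall F)⟦X⟧) = xO := by
    rw [PowerSeries.coe_aeval, PowerSeries.eval₂_X]
  rw [map_pow, hX, map_add, map_mul, PowerSeries.aeval_coe, hrx] at hev
  have hqx : IsUnit (PowerSeries.aeval ((maxNilIdealC F).isTopologicallyNilpotent _ hxM) q) :=
    (PowerSeries.isUnit_iff_constantCoeff.2 hq0).map _
  have h0 : PowerSeries.aeval ((maxNilIdealC F).isTopologicallyNilpotent _ hxM) G *
      PowerSeries.aeval ((maxNilIdealC F).isTopologicallyNilpotent _ hxM) q = 0 := by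
    linear_combination -hev
  exact hqx.mul_left_eq_zero.1 h0

omit [Fact (¬ IsUnit (p : integerC F))] in
/-- **Division by `p` on `Ŵ(𝔪_{ℂ_F})` at height one** (points version of `exists_evalPt₁_formalMul_prime_eq`).
[cite: SilvermanAEC2009, IV.4.4 and IV.7] [cite: LubinTate1965, §1] -/
theorem exists_pt_nsmul_eq {A : Type*} [CommRing A] [UniformSpace A] [DiscreteUniformity A] [Algebra A (CBall F)]
    [ContinuousSMul A (CBall F)] (hpC : ‖(p : CompletedAlgClosure F)‖ < 1) (W : WeierstrassCurve A)
    (h1 : IsUnit (algebraMap A (CBall F) (PowerSeries.coeff p (W.formalMul p)))) (P : W.Pt (maxNilIdealC F)) :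
    ∃ Q : W.Pt (maxNilIdealC F), p • Q = P := by
  obtain ⟨s, hs⟩ := exists_evalPt₁_formalMul_prime_eq hpC W h1 P.val
  exact ⟨⟨s⟩, WeierstrassCurve.Pt.ext (by rw [WeierstrassCurve.Pt.val_nsmul]; exact hs)⟩

omit [Fact (¬ IsUnit (p : integerC F))] in
/-- ★★ **A point of exact order `p` in `Ŵ(𝔪_{ℂ_F})` at height one.** [cite: SilvermanAEC2009, IV.7] [cite: LubinTate1965, §1] -/
theorem exists_pt_ne_zero_nsmul_eq_zero {A : Type*} [CommRing A] [UniformSpace A] [DiscreteUniformity A] [Algebra A (CBall F)]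
    [ContinuousSMul A (CBall F)] (hpC : ‖(p : CompletedAlgClosure F)‖ < 1) (W : WeierstrassCurve A)
    (h1 : IsUnit (algebraMap A (CBall F) (PowerSeries.coeff p (W.formalMul p)))) :
    ∃ P : W.Pt (maxNilIdealC F), P ≠ 0 ∧ p • P = 0 := by
  have h1' : IsUnit (PowerSeries.coeff p ((W.map (algebraMap A (CBall F))).formalMul p)) := by
    rw [← WeierstrassCurve.map_formalMul, PowerSeries.coeff_map]; exact h1
  obtain ⟨x, hx0, hx⟩ := exists_ne_zero_aeval_formalMul_prime_eq_zero hpC (W.map (algebraMap A (CBall F))) h1'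
  refine ⟨⟨x⟩, fun h => hx0 ?_, ?_⟩
  · have h' := (WeierstrassCurve.Pt.eq_zero_iff _).1 h
    change x = 0 at h'
    rw [h', ZeroMemClass.coe_zero]
  · rw [WeierstrassCurve.Pt.nsmul_eq_zero_iff]
    apply Subtype.ext
    rw [← aeval_map_algebraMap_eq_evalPt₁ (W.formalMul p) (W.constantCoeff_formalMul p), WeierstrassCurve.map_formalMul,
      ZeroMemClass.coe_zero]
    exact hx

omit [Fact (¬ IsUnit (p : integerC F))] in
/-- ★★ **`T_pŴ(𝔪_{ℂ_F}) ≠ 0` at height one**: a `[p]`-division tower above a point of exact order `p`.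
[cite: SilvermanAEC2009, IV.7] [cite: Tate1967, §2.2] -/
theorem exists_tateModule_pt_ne_zero {A : Type*} [CommRing A] [UniformSpace A] [DiscreteUniformity A] [Algebra A (CBall F)]
    [ContinuousSMul A (CBall F)] (hpC : ‖(p : CompletedAlgClosure F)‖ < 1) (W : WeierstrassCurve A)
    (h1 : IsUnit (algebraMap A (CBall F) (PowerSeries.coeff p (W.formalMul p)))) :
    ∃ τ : TateModule (W.Pt (maxNilIdealC F)) p, τ ≠ 0 := by
  obtain ⟨t₁, ht₁0, ht₁⟩ := exists_pt_ne_zero_nsmul_eq_zero hpC W h1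
  have hdiv : ∀ P : W.Pt (maxNilIdealC F), ∃ Q : W.Pt (maxNilIdealC F), p • Q = P ∧ (P = 0 → Q = t₁) := fun P => by
    by_cases hP : P = 0
    · exact ⟨t₁, by rw [hP]; exact ht₁, fun _ => rfl⟩
    · obtain ⟨Q, hQ⟩ := exists_pt_nsmul_eq hpC W h1 P
      exact ⟨Q, hQ, fun h => absurd h hP⟩
  choose d hd hd0 using hdiv
  have ha_succ : ∀ n, d^[n + 1] 0 = d (d^[n] 0) := fun n => Function.iterate_succ_apply' d n 0
  have hcompat : ∀ n, p • d^[n + 1] 0 = d^[n] 0 := fun n => by rw [ha_succ, hd]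
  have htors : ∀ n, p ^ n • d^[n] 0 = (0 : W.Pt (maxNilIdealC F)) := by
    intro n
    induction n with
    | zero => rw [pow_zero, one_smul, Function.iterate_zero_apply]
    | succ n ih => rw [pow_succ, mul_smul, hcompat, ih]
  refine ⟨TateModule.mk (fun n => d^[n] 0) htors hcompat, fun h => ht₁0 ?_⟩
  have hproj := congrArg (TateModule.proj p 1) h
  rw [TateModule.proj_mk, map_zero, ha_succ 0, Function.iterate_zero_apply, hd0 0 rfl] at hproj
  exact hproj

/-! ## §4 `T_pŴ(𝔪_{ℂ_F}) = ℤ_p · v₀` and the unit-root character -/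

omit [Fact (¬ IsUnit (p : integerC F))] in
/-- ★★★ **The Tate module of a height-one formal group is free of rank one**: if `[Xᵖ][p]_W` maps to a unit of `𝒪_{ℂ_F}` then
`T_pŴ(𝔪_{ℂ_F}) = ℤ_p · v₀` with `v₀ ≠ 0` (`#Ŵ[p] ≤ p`, `T_pŴ ≠ 0`, and `TateModuleMonogenic`).
[cite: SilvermanAEC2009, IV.7] [cite: Tate1967, §2.2] [cite: LubinTate1965, §1] -/
theorem exists_generator_tateModule_pt_of_isUnit {A : Type*} [CommRing A] [UniformSpace A] [DiscreteUniformity A]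
    [Algebra A (CBall F)] [ContinuousSMul A (CBall F)] (hpC : ‖(p : CompletedAlgClosure F)‖ < 1) (W : WeierstrassCurve A)
    (h1 : IsUnit (algebraMap A (CBall F) (PowerSeries.coeff p (W.formalMul p)))) :
    ∃ v₀ : TateModule (W.Pt (maxNilIdealC F)) p, v₀ ≠ 0 ∧ ∀ τ : TateModule (W.Pt (maxNilIdealC F)) p, ∃ c : ℤ_[p], τ = c • v₀ :=
  TateModule.exists_generator_of_card_torsionBy_le (card_torsion_pt_le_of_isUnit hpC W h1) (exists_tateModule_pt_ne_zero hpC W h1)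

omit [Fact (¬ IsUnit (p : integerC F))] in
/-- ★★★ **The unit-root character of a height-one formal group over `𝒪_F`.** For `W` over `𝒪_F` with `[Xᵖ][p]_W` a unit of
`𝒪_{ℂ_F}` (ordinary reduction): `T_pŴ(𝒪_{ℂ_F}) = ℤ_p · v₀`, `v₀ ≠ 0`, and `Γ_F` acts on it through a nowhere-vanishing
`ρ : Γ_F → ℤ_p`, `σ • v₀ = ρ(σ) • v₀`. [cite: SilvermanAEC2009, IV.7 and VII.2] [cite: Tate1967, §2.2 and §4] -/
theorem exists_generator_tatePtO_of_isUnit (hpC : ‖(p : CompletedAlgClosure F)‖ < 1) (W : WeierstrassCurve (LTCoeff F))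
    (h1 : IsUnit (algebraMap (LTCoeff F) (CBall F) (PowerSeries.coeff p (W.formalMul p)))) :
    ∃ v₀ : AinfTop.TatePtO F W p, v₀ ≠ 0 ∧ (∀ τ : AinfTop.TatePtO F W p, ∃ c : ℤ_[p], τ = c • v₀) ∧
      ∃ ρ : absoluteGaloisGroup F → ℤ_[p], ∀ σ : absoluteGaloisGroup F, σ • v₀ = ρ σ • v₀ ∧ ρ σ ≠ 0 := by
  obtain ⟨v₀, hv₀, hgen⟩ := exists_generator_tateModule_pt_of_isUnit hpC W h1
  exact ⟨v₀, hv₀, hgen, TateModule.exists_character_of_generator hv₀ hgen⟩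

end Literature.NumberTheory.PAdicHodge
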